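import Literature.IUT.LogVolume.SubThetaFieldRamificationSixty
import Literature.IUT.LogVolume.ThetaFieldReadingClosure
import Literature.NumberTheory.GaloisRepresentations.TameInertiaGlobalCyclic
import Literature.NumberTheory.EllipticCurves.TateModuleTameDescentProofs
import HarnessLib

/-!
# The ramification of a field pinned by the v3 Θ-datum DIVIDES `30` at every BAD place away from `2·3·5`
# (sharpening of `SubThetaFieldRamificationSixty` by the CYCLICITY of tame inertia; proof-only)

J.-P. Serre, *Local Fields* (GTM 67), Ch. IV §2, Cor. 1 of Prop. 7 ("`G_0/G_1` is cyclic") and Cor. 3 (a group of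
order prime to `p` has trivial wild part); J.-P. Serre, *Propriétés galoisiennes des points d'ordre fini des courbes
elliptiques*, Invent. Math. **15** (1972), §1.11–§1.12; Mochizuki, *Inter-universal Teichmüller theory IV*, Thm. 1.10
Step (iii) (R2)–(R4) p. 25–26 (locus of use only).

This seat's `Cor22.ramificationIdx_subThetaField_dvd_sixty` proves `e(w | v) ∣ 60 = 2·3·5·2` for a place `w` of a field
`F` pinned by `IsSubThetaField P F` (`F ⊆ F_tpd(√−1, √λ, √(λ−1), E_λ[15])`, Galois over `F_tpd`) over a BAD place
`v ∤ 30` of `λ`, by an index chain in the absolute inertia group `I = I_𝔓` in which the two quadratic steps (the twist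
character of `√d` and the twist roots `√λ`, `√(λ−1)`) each cost a factor `2`. THIS FILE removes the spurious factor:
since `p_v ∤ [F : F_tpd] ∣ 2¹²·3²·5`, the restriction of `I` to `Gal(F/F_tpd)` kills the wild ramification groups
(the tree's tame descent `absUpperRamificationSubgroup_le_of_not_dvd_index`, abc-iut / Serre IV §2 Cor. 3), so its image
is CYCLIC, generated by the restriction of one `s ∈ I` (the tree's
`exists_map_inertia_eq_zpowers_of_forall_absUpperRamificationSubgroup`, Serre IV §2 Cor. 1); and `s^30` fixes `F`:
`s²` fixes every square root (index `∣ 2`) and lies in `Γ_{F_tpd(√d)}`, where `ρ̄_{E_λ,3}`, `ρ̄_{E_λ,5}` have exponent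
`3`, `5` on inertia (unipotence at the multiplicative twist, abc-iut-L5-t12's
`galoisRepTorsion_pow_eq_one_of_mem_inertia_of_hasMultiplicativeReductionAt_quadraticTwist`), so `ρ̄₃(s^30) = ρ̄₅(s^30) = 1`.
Hence `e(w | v) ∣ ord(s|_F) ∣ 30`:

* **`Cor22.ramificationIdx_subThetaField_dvd_thirty`** — `P ∈ U`, `F` Galois over `F_tpd` with `IsSubThetaField P F`,
  `w | v` with `v ∈ badPlaces P` and `30 ∉ v` ⇒ **`e(w | v) ∣ 30`** — the exact local type of the Tate curve
  (`e ∣ 2·15`: the twist character times the Kummer extension `F_v(μ₁₅, q^{1/15})`, numerically `e ∈ {e_x, 2e_x}`,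
  `e_x = 15/gcd(15, ord_v q)`, abc-iut rw-num-lead WINDOW-TABLE v1 A1 / kit N1b).

Proof-only (no definition, no named fact); classical; TAKES NO SIDE on [IUTchIII] Cor. 3.12.
-/

noncomputable section

open scoped Classical

namespace Literature.IUT.LogVolume

namespace Cor22

open NumberField IsDedekindDomain Literature.NumberTheory.DiophantineGeometry.GenEll
open Literature.NumberTheory.EllipticCurves Literature.NumberTheory.GaloisRepresentations
open Literature.NumberTheory.NumberFields WeierstrassCurve IntermediateField Field

variable {P : NFPoint} (F : Type) [Field F] [NumberField F] [Algebra P.F F]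

/-- **`e(w | v) ∣ 30` for every place `w` of a field pinned by `IsSubThetaField P F` (Galois over `F_tpd`) over a
BAD place `v ∤ 2·3·5` of `λ`.** The image of the absolute inertia group `I_𝔓` in `Gal(F/F_tpd)` is tame
(`p_v ∤ [F : F_tpd] ∣ 2¹²·3²·5`), hence CYCLIC (Serre IV §2 Cor. 1), generated by the restriction of one `s ∈ I_𝔓`; and
`s^{30}` fixes `F`: `s²` fixes `√−1, √λ, √(λ−1)` and `√d` for the multiplicative twist `E_λ^{(d)}` at `v`, on whose
stabiliser `ρ̄_{E_λ,3}`, `ρ̄_{E_λ,5}` have exponent `3`, `5` along inertia (Serre 1972 §1.12). So `e(w|v) ∣ ord(s|_F) ∣ 30`.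
[cite: SerreLocalFields1979, Ch. IV §2 Cor. 1 and Cor. 3 of Prop. 7] [cite: Serre1972, §1.11–§1.12]
[cite: Mochizuki2012, IUTchIV Thm 1.10 proof Step (iii) (R2)–(R4) p.25–26] -/
theorem ramificationIdx_subThetaField_dvd_thirty (hU : P.InU) (hF : IsSubThetaField P F) [IsGalois P.F F]
    (w : HeightOneSpectrum (𝓞 F)) (hbad : finBelow P.F F w ∈ badPlaces P)
    (h30 : ((30 : ℕ) : 𝓞 P.F) ∉ (finBelow P.F F w).asIdeal) :
    w.asIdeal.ramificationIdx (𝓞 P.F) ∣ 30 := by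
  haveI : P.legendreCurve.IsElliptic := P.legendreCurve_isElliptic_iff.2 hU
  haveI : Fact (Nat.Prime 3) := ⟨Nat.prime_three⟩
  haveI : Fact (Nat.Prime 5) := ⟨Nat.prime_five⟩
  set v := finBelow P.F F w with hvdef
  haveI := v.isPrime
  -- residue characteristic `∉ {2, 3, 5}`
  have h2 : ((2 : ℕ) : 𝓞 P.F) ∉ v.asIdeal := fun h => h30 (by
    rw [show (30 : ℕ) = 15 * 2 from rfl, Nat.cast_mul]; exact Ideal.mul_mem_left _ _ h)
  have h3 : ((3 : ℕ) : 𝓞 P.F) ∉ v.asIdeal := fun h => h30 (by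
    rw [show (30 : ℕ) = 10 * 3 from rfl, Nat.cast_mul]; exact Ideal.mul_mem_left _ _ h)
  have h5 : ((5 : ℕ) : 𝓞 P.F) ∉ v.asIdeal := fun h => h30 (by
    rw [show (30 : ℕ) = 6 * 5 from rfl, Nat.cast_mul]; exact Ideal.mul_mem_left _ _ h)
  -- `F ≃ L := F_tpd(φ S) ⊆ F̄_tpd`
  haveI : FiniteDimensional P.F F := Module.Finite.of_restrictScalars_finite ℚ P.F F
  set Ω := AlgebraicClosure P.F
  let φ : F →ₐ[P.F] Ω := IsAlgClosed.lift
  set S : Set F := subThetaFieldGenerators P F with hSdef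
  set L : IntermediateField P.F Ω := IntermediateField.adjoin P.F (φ '' S) with hLdef
  have hL : φ.fieldRange = L := by
    rw [AlgHom.fieldRange_eq_map, ← hF.adjoin_eq_top, IntermediateField.adjoin_map]
  let e : F ≃ₐ[P.F] L :=
    (((IntermediateField.topEquiv (F := P.F) (E := F)).symm.trans (IntermediateField.equivMap ⊤ φ)).trans
      (IntermediateField.equivOfEq (AlgHom.fieldRange_eq_map φ).symm)).trans
      (IntermediateField.equivOfEq hL)
  haveI : FiniteDimensional P.F L := LinearEquiv.finiteDimensional e.toLinearEquiv
  haveI : IsGalois P.F L := IsGalois.of_algEquiv e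
  haveI : NumberField L := NumberField.of_module_finite P.F L
  -- `[L : F_tpd] ∣ 2¹²·3²·5`
  have hdegL : Module.finrank P.F L ∣ 2 ^ 12 * 3 ^ 2 * 5 := by
    rw [← e.toLinearEquiv.finrank_eq]
    exact hF.finrank_dvd_bound P hU
  -- absolute inertia at `v`
  obtain ⟨𝔓, h𝔓⟩ := HeightOneSpectrum.primesAbove_nonempty v
  haveI : 𝔓.IsPrime := h𝔓.1
  haveI : 𝔓.LiesOver v.asIdeal := h𝔓.2
  set I : Subgroup (absoluteGaloisGroup P.F) := 𝔓.inertia (absoluteGaloisGroup P.F) with hIdef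
  -- (1) the restriction of `I` to `Gal(L/F_tpd) = Γ/Γ_L` is CYCLIC, generated by the class of some `s ∈ I`
  set N₀ : Subgroup (absoluteGaloisGroup P.F) := L.fixingSubgroup with hN₀
  haveI hN₀n : N₀.Normal := IsGalois.fixingSubgroup_normal_of_isGalois L
  have hN₀open : IsOpen (N₀ : Set (absoluteGaloisGroup P.F)) := IntermediateField.fixingSubgroup_isOpen L
  haveI : DiscreteTopology (absoluteGaloisGroup P.F ⧸ N₀) := QuotientGroup.discreteTopology hN₀open
  let π : absoluteGaloisGroup P.F →ₜ* (absoluteGaloisGroup P.F ⧸ N₀) :=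
    ⟨QuotientGroup.mk' N₀, QuotientGroup.continuous_mk⟩
  have hπ : π.toMonoidHom = QuotientGroup.mk' N₀ := rfl
  -- tameness: the residue characteristic does not divide `[L : F_tpd] = [Γ : Γ_L]`
  have htame : ¬ ringChar (𝓞 P.F ⧸ v.asIdeal) ∣ N₀.index := by
    haveI : Finite (𝓞 P.F ⧸ v.asIdeal) := Ideal.finiteQuotientOfFreeOfNeBot v.asIdeal v.ne_bot
    letI : Field (𝓞 P.F ⧸ v.asIdeal) := Ideal.Quotient.field _
    set p : ℕ := ringChar (𝓞 P.F ⧸ v.asIdeal) with hpdef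
    have hpprime : p.Prime := CharP.char_is_prime (𝓞 P.F ⧸ v.asIdeal) p
    have hpv : ((p : ℕ) : 𝓞 P.F) ∈ v.asIdeal := by
      rw [← Ideal.Quotient.eq_zero_iff_mem, map_natCast, hpdef]
      exact ringChar.Nat.cast_ringChar
    have hidx : N₀.index = Module.finrank P.F L := (IntermediateField.finrank_eq_fixingSubgroup_index L).symm
    rw [hidx]
    intro h
    have h' := h.trans hdegL
    rcases (Nat.Prime.dvd_mul hpprime).1 h' with h23 | h5'
    · rcases (Nat.Prime.dvd_mul hpprime).1 h23 with h2' | h3'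
      · exact h2 (((Nat.prime_dvd_prime_iff_eq hpprime Nat.prime_two).1 (hpprime.dvd_of_dvd_pow h2')) ▸ hpv)
      · exact h3 (((Nat.prime_dvd_prime_iff_eq hpprime Nat.prime_three).1 (hpprime.dvd_of_dvd_pow h3')) ▸ hpv)
    · exact h5 (((Nat.prime_dvd_prime_iff_eq hpprime Nat.prime_five).1 h5') ▸ hpv)
  have hwild : ∀ u : ℝ, 0 < u → ∀ σ ∈ absUpperRamificationSubgroup (𝓞 P.F) 𝔓 u, π σ = 1 := by
    intro u hu σ hσ
    have hσN : σ ∈ N₀ := absUpperRamificationSubgroup_le_of_not_dvd_index h𝔓 N₀ hN₀open htame hu hσ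
    exact (QuotientGroup.eq_one_iff σ).2 hσN
  obtain ⟨s, hs, hcyc⟩ := exists_map_inertia_eq_zpowers_of_forall_absUpperRamificationSubgroup h𝔓 π hwild
  -- (2) `s^30` fixes `L`
  -- every square root is fixed by `s²` (index `∣ 2`, normal)
  have hsq : ∀ a : P.F, s ^ 2 ∈ sqrtFixer P a := by
    intro a
    haveI : IsGalois P.F (adjoin P.F {z : AlgebraicClosure P.F | z ^ 2 = algebraMap P.F _ a}) := isGalois_adjoin_sqrtSet _
    haveI : (sqrtFixer P a).Normal := IsGalois.fixingSubgroup_normal_of_isGalois _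
    have hidx : (sqrtFixer P a).index ∣ 2 := index_fixingSubgroup_adjoin_sqrtSet_dvd_two a
    have hmem : s ^ (sqrtFixer P a).index ∈ sqrtFixer P a := Subgroup.pow_index_mem _ s
    rcases (Nat.dvd_prime Nat.prime_two).1 hidx with h1 | h2i
    · rw [h1, pow_one] at hmem
      exact Subgroup.pow_mem _ hmem 2
    · rwa [h2i] at hmem
  -- a multiplicative quadratic twist of `E_λ` at the bad place `v`; `s² ∈ Γ_{F_tpd(√d)}`
  have hord : ord P.F v (jInv P.x) < 0 := (mem_badPlaces_iff_ord_neg P v).1 hbad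
  have hj0 : jInv P.x ≠ 0 := fun h0 => by
    rw [h0, ord_zero] at hord
    exact lt_irrefl _ hord
  have hj : 1 < v.valuation P.F P.legendreCurve.j := by
    have hjl : P.legendreCurve.j = jInv P.x := j_legendre P hU
    rw [hjl]
    exact (ord_neg_iff_one_lt_valuation P.F v hj0).1 hord
  obtain ⟨d, hd, hmult⟩ := P.legendreCurve.exists_hasMultiplicativeReductionAt_quadraticTwist_of_one_lt_valuation_j v hj
  set N : Subgroup (absoluteGaloisGroup P.F) := MulAction.stabilizer (absoluteGaloisGroup P.F) (geomSqrt d) with hNdef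
  haveI hNn : N.Normal := stabilizer_geomSqrt_normal d
  have hs2N : s ^ 2 ∈ N := by
    have hmem : s ^ N.index ∈ N := Subgroup.pow_index_mem _ s
    rcases index_stabilizer_geomSqrt (K := P.F) d with h1 | h2i
    · rw [h1, pow_one] at hmem
      exact Subgroup.pow_mem _ hmem 2
    · rw [hNdef, h2i] at hmem; exact hmem
  have hs2I : s ^ 2 ∈ I := Subgroup.pow_mem _ hs 2
  -- unipotence: `ρ̄_p(s²)^p = 1` for `p = 3, 5`, hence `ρ̄_p(s^30) = 1`
  have hunip : ∀ {p : ℕ}, p.Prime → ((p : ℕ) : 𝓞 P.F) ∉ v.asIdeal →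
      P.legendreCurve.galoisRepTorsion (p : ℤ) (s ^ 2) ^ p = 1 := fun hp hpv =>
    P.legendreCurve.galoisRepTorsion_pow_eq_one_of_mem_inertia_of_hasMultiplicativeReductionAt_quadraticTwist
      hp hd hmult hpv h𝔓 hs2I hs2N
  have h3ker : s ^ 30 ∈ (P.legendreCurve.galoisRepTorsion ((3 : ℕ) : ℤ)).ker := by
    rw [MonoidHom.mem_ker, show (30 : ℕ) = 2 * (3 * 5) by norm_num, pow_mul, map_pow, pow_mul,
      hunip Nat.prime_three h3, one_pow]
  have h5ker : s ^ 30 ∈ (P.legendreCurve.galoisRepTorsion ((5 : ℕ) : ℤ)).ker := by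
    rw [MonoidHom.mem_ker, show (30 : ℕ) = 2 * (5 * 3) by norm_num, pow_mul, map_pow, pow_mul,
      hunip Nat.prime_five h5, one_pow]
  have hsq30 : ∀ a : P.F, s ^ 30 ∈ sqrtFixer P a := fun a => by
    rw [show (30 : ℕ) = 2 * 15 by norm_num, pow_mul]
    exact Subgroup.pow_mem _ (hsq a) 15
  -- hence `s^30` fixes every generator of `L`
  have hs30 : s ^ 30 ∈ N₀ := by
    set τ := s ^ 30 with hτ
    refine mem_fixingSubgroup_adjoin_of_forall_eq (σ := Field.absoluteGaloisGroup.toAlgEquiv P.F τ) fun t ht => ?_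
    obtain ⟨x, hx, rfl⟩ := ht
    rcases hx with (hsq' | hsq' | hsq') | htor
    · -- `x² = −1`
      have : (φ x) ^ 2 = algebraMap P.F Ω (-1) := by rw [← map_pow, hsq', map_neg, map_one, map_neg, map_one]
      exact forall_eq_of_mem_fixingSubgroup_adjoin (hsq30 (-1)) _ this
    · -- `x² = λ`
      have : (φ x) ^ 2 = algebraMap P.F Ω P.x := by rw [← map_pow, hsq', φ.commutes]
      exact forall_eq_of_mem_fixingSubgroup_adjoin (hsq30 P.x) _ this
    · -- `x² = λ − 1`
      have : (φ x) ^ 2 = algebraMap P.F Ω (P.x - 1) := by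
        rw [← map_pow, hsq', map_sub, map_one, φ.commutes, map_sub, map_one]
      exact forall_eq_of_mem_fixingSubgroup_adjoin (hsq30 (P.x - 1)) _ this
    · -- a `15`-torsion coordinate
      rw [torsionCoords_eq] at htor
      obtain ⟨T, hT, hxT⟩ := Set.mem_iUnion₂.1 htor
      have hT15 : (15 : ℤ) • T = 0 := hT
      let T' : geomPoints P.legendreCurve := Affine.Point.map (W' := P.legendreCurve.toAffine) φ T
      have hT' : (15 : ℤ) • T' = 0 := by
        change (15 : ℤ) • Affine.Point.map (W' := P.legendreCurve.toAffine) φ T = 0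
        rw [← map_zsmul, hT15, map_zero]
      have h3' : ∀ Q : geomTorsion P.legendreCurve ((3 : ℕ) : ℤ), τ • Q = Q := by
        intro Q
        have hQ := galoisRepTorsion_apply P.legendreCurve ((3 : ℕ) : ℤ) τ Q
        rw [(MonoidHom.mem_ker).1 h3ker] at hQ
        exact hQ.symm
      have h5' : ∀ Q : geomTorsion P.legendreCurve ((5 : ℕ) : ℤ), τ • Q = Q := by
        intro Q
        have hQ := galoisRepTorsion_apply P.legendreCurve ((5 : ℕ) : ℤ) τ Q
        rw [(MonoidHom.mem_ker).1 h5ker] at hQ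
        exact hQ.symm
      have hfix : τ • T' = T' := smul_eq_of_fifteen τ h3' h5' T' hT'
      refine forall_coords_of_smul_eq P τ T' hfix (φ x) ?_
      rcases T with _ | ⟨a, b, hab⟩
      · simp [pointCoords] at hxT
      · change φ x ∈ pointCoords (Affine.Point.map (W' := P.legendreCurve.toAffine) φ
          (Affine.Point.some a b hab))
        rw [Affine.Point.map_some]
        simp only [pointCoords, Set.mem_insert_iff, Set.mem_singleton_iff] at hxT ⊢
        rcases hxT with rfl | rfl
        · exact Or.inl rfl
        · exact Or.inr rfl
  -- (3) `[I : I ∩ Γ_L] = #π(I) = ord(π s) ∣ 30`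
  have hrel : N₀.relIndex I ∣ 30 := by
    have hcard : N₀.relIndex I = Nat.card (I.map π.toMonoidHom) := by
      rw [← Subgroup.relIndex_ker I π.toMonoidHom, hπ, QuotientGroup.ker_mk']
    rw [hcard, hcyc, Nat.card_zpowers]
    refine orderOf_dvd_of_pow_eq_one ?_
    rw [← map_pow]
    exact (QuotientGroup.eq_one_iff (s ^ 30)).2 hs30
  -- (4) `e(w | v)`, read on the inertia group of `Gal(L/F_tpd)`, divides `[I : I ∩ Γ_L]`
  set Q : Ideal (𝓞 L) := w.asIdeal.map (RingOfIntegers.mapAlgEquiv e : 𝓞 F ≃ₐ[𝓞 P.F] 𝓞 L) with hQ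
  haveI : Q.IsPrime := isPrime_map_mapAlgEquiv e w
  haveI : Q.LiesOver v.asIdeal := liesOver_map_mapAlgEquiv e w _
  rw [← ramificationIdx_map_mapAlgEquiv e w]
  set r : absoluteGaloisGroup P.F →* (L ≃ₐ[P.F] L) := AlgEquiv.restrictNormalHom L with hr
  have hker : r.ker = N₀ := IntermediateField.restrictNormalHom_ker L
  have h1 : (𝔓.comap (ringOfIntegersToIntegralClosure (k := P.F) (Ω := Ω) L)).inertia (L ≃ₐ[P.F] L) ≤
      I.map r := by
    intro g hg
    obtain ⟨σ, hσ, hσg⟩ := @exists_mem_inertia_restrict_eq P.F _ _ L _ _ 𝔓 h𝔓.1 g hg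
    refine ⟨σ, hσ, AlgEquiv.ext fun x => Subtype.ext ?_⟩
    change (algebraMap L Ω) ((σ.restrictNormal L) x) = (algebraMap L Ω) (g x)
    rw [AlgEquiv.restrictNormal_commutes]
    exact hσg x
  rw [@ramificationIdx_eq_card_inertia_comap P.F _ _ L _ _ v 𝔓 h𝔓.1 h𝔓.2 Q _ _]
  have hdvd : Nat.card ((𝔓.comap (ringOfIntegersToIntegralClosure (k := P.F) (Ω := Ω) L)).inertia
      (L ≃ₐ[P.F] L)) ∣ N₀.relIndex I := by
    have h := Subgroup.card_dvd_of_le h1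
    rwa [← Subgroup.relIndex_ker I r, hker] at h
  exact hdvd.trans hrel

end Cor22

end Literature.IUT.LogVolume

end
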